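import Literature.AlgebraicGeometry.Hyperkaehler.GeneralizedKummerType
import Literature.AlgebraicGeometry.HodgeTheory.HodgeConjecture
import Literature.AlgebraicGeometry.Motives.MotivatedPeriodTorsor
import HarnessLib

/-!
# The Hodge conjecture for Beauville's generalized Kummer varieties `Kⁿ(A)` themselves and their powers (Xu 2018, Thm. 1.3) — NAMED FACT

Layer `Literature/AlgebraicGeometry/Hyperkaehler`.  CITE record for the Hodge-ladder stage-4 scoping
(run/shared/lean/pub/hodge-director/STAGE4-ABELIAN-MOTIVIC-TYPE.md v4, row 2b and §0-bis): for the
ACTUAL generalized Kummer varieties `Kⁿ(A)` of complex abelian surfaces (file `GeneralizedKummerType`: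
`IsGeneralizedKummerVarietyOf n A K`) — as opposed to the whole deformation class
`IsOfGeneralizedKummerType n` (for which the Hodge conjecture is in print only for `n = 2, 3` and for
the degree-`2`-generated classes, file `GeneralizedKummerTypeHodgeConjecture`) — the Hodge conjecture
is a THEOREM in every dimension, and for all products, UNCONDITIONALLY: the Chow motive of `Kⁿ(A)` lies
in the tensor category generated by the motive of `A` (Xu Thm. 1.1 / Cor. 1.2; de Cataldo–Migliorini),
so `Kⁿ(A)` is "motivated by `A`" (Xu Lemma 3.2) and inherits the Hodge conjecture from the products of
abelian surfaces (Arapura 2006 Lemma 4.2; Ramón Marí 2008) — the STRICT "abelian motivic type"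
mechanism of the scoping document, with nothing beyond the abelian-variety input.

## Source (read: arXiv text `paper:arxiv-1506.04297`)

Z. Xu, *Algebraic cycles on a generalized Kummer variety*, Int. Math. Res. Not. IMRN 2018, no. 3,
932–948 [Xu2018Kummer].  §1: "Let `A` be a complex abelian surface. For any positive integer `n`, let
`A^{(n)}` be the `n`-th symmetric product of `A` and `A^{[n]}` be the Hilbert scheme of closed subschemes
of length `n` on `A`. Let `π : A^{[n]} → A^{(n)}` be the Hilbert-Chow morphism and `σ : A^{(n)} → A` be
the addition morphism. Let `α := σ ∘ π : A^{[n]} → A` […] If `n ≥ 2`, then the fiber `K^{[n]} := α⁻¹(o_A)`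
is a projective hyperkähler variety of dimension `2(n-1)`, called the `n`-th generalized Kummer variety
associated to `A` [Bea83]. In fact, `K^{[2]}` is just the Kummer K3 surface associated to `A`."
**Theorem 1.1**: "in the category of Chow motives, there is a canonical isomorphism
`h(K^{[n]}) ≅ ⊕_{λ ∈ P(n)} ⊕_{τ ∈ A[e(λ)]} h(K_τ^{(λ)}) ⊗ 𝕃^{n-ℓ(λ)}`."  **Theorem 1.3** (= Thm. 3.3):
"Let `A_i (1 ≤ i ≤ r)` be complex abelian surfaces and `K_i^{[n_i]}` be the `n_i`-th generalized Kummer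
variety associated to `A_i`. Then the Hodge conjecture holds for the product
`K_1^{[n_1]} × ⋯ × K_r^{[n_r]}`."  Proof of Thm. 3.3: "This is implie[d] by Theorem 3.1 [= Arapura 2006,
Lemma 4.2], Lemma 3.2 [`K_1^{[n_1]} × ⋯ × K_r^{[n_r]}` is motivated by `A_1 × ⋯ × A_r`] and the fact
that the Hodge conjecture holds for arbitrary products of complex abelian surfaces. For the last point,
see, for example, [RM08]."  Remark 3.4: "in general, Hodge cycles on generalized Kummer varieties of
dimension at least `4` cannot be represented by Lefschetz classes."

## Rendering and faithfulness

* Indexing: Xu's `K^{[n+1]} ⊂ A^{[n+1]}` (dimension `2n`, defined for `n + 1 ≥ 2`) is Beauville's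
  `Kₙ = Kⁿ(A)`, i.e. the tree's `IsGeneralizedKummerVarietyOf n A K` (module docstring of
  `GeneralizedKummerType`: "`K` the PULL-BACK of the unit section along `s₀ = alb - alb(x₀)`", the
  fibre `S⁻¹(S(x₀)) ≅ Kⁿ(A)`; the choice of `x₀` is immaterial by isotriviality, Xu §1 "after the base
  change by `𝐧 : A → A`, it is a trivial fibration").  We require `1 ≤ n` (Xu's `n + 1 ≥ 2`) and
  `A.dim = 2` ("complex abelian surface").
* "projective hyperkähler variety of dimension `2(n-1)`": the companion clause
  `Motives.IsSmoothProjective (2 * n) K` (Beauville §7 Théorème 4 — a theorem about the witness,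
  carried as a hypothesis exactly as in `IsOfGeneralizedKummerType` and in the records of
  `GeneralizedKummerTypeHodgeConjecture`).
* Products: Thm. 1.3 is stated for arbitrary finite products `K_1^{[n_1]} × ⋯ × K_r^{[n_r]}`; recorded
  here are the case `r = 1` (`HodgeConjectureFor (2 * n) K`) and the case of equal factors, i.e. the
  positive cartesian powers `K^{m+1}` (`Motives.SchemeOver.pow`, dimension `(m + 1) * (2 * n)`), which
  is what the stage-4 rows quantify over.
  -- TODO(general form): finite products of generalized Kummer varieties of DIFFERENT abelian surfaces
  -- and dimensions (needs an iterated-`⊗` carrier over a list of `SchemeOver ℂ`).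

## What is NOT here

Xu's Thm. 1.1 / Cor. 1.2 (the Chow motive) and Thm. 1.4 (smash-nilpotence); the Hodge conjecture for
products of abelian surfaces [RM08] (an instance of the summit's `HC_AV`); the deformation class
`Kumⁿ` (file `GeneralizedKummerTypeHodgeConjecture`); any proof.
-/

noncomputable section

namespace Literature.AlgebraicGeometry.Hyperkaehler

/-- **Xu 2018, Thm. 1.3 (cases `r = 1` and equal factors): every rational Hodge class on a generalized
Kummer variety `Kⁿ(A)` of a complex abelian surface `A` (`n ≥ 1`, dimension `2n`; `n = 1`: the Kummer
surface), and on each of its cartesian powers, is algebraic** (printed sentence, with the paper's name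
for the statement, in the module docstring: "Let `A_i (1 ≤ i ≤ r)` be complex abelian surfaces and
`K_i^{[n_i]}` be the `n_i`-th generalized Kummer variety associated to `A_i`. Then [every rational Hodge
class is algebraic on] the product `K_1^{[n_1]} × ⋯ × K_r^{[n_r]}`"; Xu's `K^{[n+1]}`, of dimension
`2n`, is the tree's `IsGeneralizedKummerVarietyOf n A K`, module docstring).  Rendering: for
`A : Motives.AbelianVariety ℂ` with `A.dim = 2`, `1 ≤ n`, `K` a generalized Kummer variety `Kⁿ(A)` which
is smooth projective of dimension `2n`: the tree's per-variety Hodge statement for `K` in dimension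
`2 * n`, and for the cartesian power `K.pow (m + 1)` in dimension `(m + 1) * (2 * n)`, every `m`.
UNCONDITIONAL THEOREM in print (via Arapura 2006 Lemma 4.2 and the products of abelian surfaces,
Ramón Marí 2008); status: proved; unproved in the tree. [cite: Xu2018Kummer, Thm. 1.3 (= Thm. 3.3, §3.1) and §1 (definition of K^{[n]})]
[cite: Arapura2006, Lemma 4.2] [cite: RamonMari2008, Thm. 2.14] -/
def Xu2018_hodgeClasses_algebraic_generalizedKummerVariety : Prop :=
  ∀ (n : ℕ) (A : Motives.AbelianVariety ℂ) ⦃K : Motives.SchemeOver ℂ⦄, A.dim = 2 → 1 ≤ n →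
    IsGeneralizedKummerVarietyOf n A K → Motives.IsSmoothProjective (2 * n) K →
      HodgeTheory.HodgeConjectureFor (2 * n) K ∧
        ∀ m : ℕ, HodgeTheory.HodgeConjectureFor ((m + 1) * (2 * n)) (K.pow (m + 1))

namespace Xu2018_hodgeClasses_algebraic_generalizedKummerVariety

variable {n : ℕ} {A : Motives.AbelianVariety ℂ} {K : Motives.SchemeOver ℂ}

/-- The single variety `Kⁿ(A)` (case `r = 1` of Thm. 1.3). [cite: Xu2018Kummer, Thm. 1.3] -/
theorem hodgeConjectureFor (h : Xu2018_hodgeClasses_algebraic_generalizedKummerVariety) (hA : A.dim = 2)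
    (hn : 1 ≤ n) (hK : IsGeneralizedKummerVarietyOf n A K) (hKs : Motives.IsSmoothProjective (2 * n) K) :
    HodgeTheory.HodgeConjectureFor (2 * n) K :=
  (h n A hA hn hK hKs).1

/-- The cartesian powers `Kⁿ(A)^{m+1}` (equal factors in Thm. 1.3). [cite: Xu2018Kummer, Thm. 1.3] -/
theorem hodgeConjectureFor_pow (h : Xu2018_hodgeClasses_algebraic_generalizedKummerVariety) (hA : A.dim = 2)
    (hn : 1 ≤ n) (hK : IsGeneralizedKummerVarietyOf n A K) (hKs : Motives.IsSmoothProjective (2 * n) K)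
    (m : ℕ) : HodgeTheory.HodgeConjectureFor ((m + 1) * (2 * n)) (K.pow (m + 1)) :=
  (h n A hA hn hK hKs).2 m

/-- **The Kummer surface case (`n = 1`, Xu §1: "`K^{[2]}` is just the Kummer K3 surface associated to
`A`"): the Hodge conjecture holds for all cartesian powers of the Kummer surface `Km(A) = K¹(A)` of a
complex abelian surface** — an unconditional instance of the stage-4 row-1 target (powers of K3
surfaces) for Kummer surfaces. [cite: Xu2018Kummer, Thm. 1.3 and §1] -/
theorem hodgeConjectureFor_pow_kummerSurface (h : Xu2018_hodgeClasses_algebraic_generalizedKummerVariety)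
    (hA : A.dim = 2) (hK : IsGeneralizedKummerVarietyOf 1 A K) (hKs : Motives.IsSmoothProjective 2 K)
    (m : ℕ) : HodgeTheory.HodgeConjectureFor ((m + 1) * 2) (K.pow (m + 1)) :=
  (h 1 A hA le_rfl hK hKs).2 m

end Xu2018_hodgeClasses_algebraic_generalizedKummerVariety

end Literature.AlgebraicGeometry.Hyperkaehler

end
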